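import Mathlib
import HarnessLib
import Summits.HubbardSuperconductivity.HubbardSuperconductivity.Theorems.KLProgrammeKLRegimeTwoVolumeLipDoubledTransferRows

/-!
# Route `KLProgramme` — crux K3 ENGINE (stmt-HubbardSuperconductivity-20437), stub (e) proof-input «(e)-D-ROWS», keying (A′), REKEY-D file D6T-1:
# PERIODISATION AND THE SIX BLOCK-READING ROW DATA OF THE DOUBLED JUMP `klJumpD … J′ J = klJump ⊕ shift` (any pair of scales)
# (seat hubbard-kl-k3c4-p1 g28; the text of ✓ D3b-1 `…TwoVolumeLipDoubledTransferRows` §1b–§2 with the block transfer `klLipTransferD … d k` (= the jump `(dk, dk−1)`) replaced by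
#  the general doubled jump `klJumpD … J′ J` of `…TwoVolumeLipDoubledDefs` — needed by the re-measurement ((Dμ)⁺ row) of the truncated doubled tower, whose summands are
#  jump-transferred from the families `d−1` and `dk′` to `dk−1`; `--supports` 23356)

* `klJumpD_periodise` — `Σ_{resD Y′ = Y} klJumpD (bL) … X′ Y′ = klJumpD L … (resD X′) Y` (copy 0: ✓ `klJump_periodise`; copy 1: ✓ `klPlainShift_periodise`);
* `klJumpD_apply_00/_11/_01/_10` and the six row data **`hwinJ_le · hrhoJ_le · htau1J_le · htau2J_le · htau3J_le · htau4J_le`** (sector data of `klJump (bL) J′ J` on copy 0,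
  `≤ 1 ≤ a` / `= 0` on the plain copy; plain pin: in-block partner fact `hW`).

Bookkeeping on landed objects (proofs = D3b-1's); nothing asserts the (D) rows, (e), VL, K3 or superconductivity.
References: BGM 2006 §2.7 (2.70)–(2.71) [cite: BenfattoGiulianiMastropietro2006]; Salmhofer 1999 App. B.2 (B.23)–(B.25).
-/

noncomputable section

namespace Summit.HubbardSuperconductivity.HubbardSuperconductivity.Theorems.TwoVolumeLip

set_option linter.dupNamespace false -- summit = problem name (single-conjunct summit), D-0017

open Finset Literature.MathematicalPhysics.QuantumLattice GrassmannAlgebra Literature.Probability.LatticeModels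
open Literature.MathematicalPhysics.QuantumLattice.FermiRG
open Summit.HubbardSuperconductivity.HubbardSuperconductivity.Theorems.KLRegimeSplit
open Summit.HubbardSuperconductivity.HubbardSuperconductivity.Theorems.KLProgrammeLegKernels
open Summit.HubbardSuperconductivity.HubbardSuperconductivity.Theorems.EngineV8
open Summit.HubbardSuperconductivity.HubbardSuperconductivity.Theorems.TwoVolumeSource
open Summit.HubbardSuperconductivity.HubbardSuperconductivity.Theorems.TwoVolumeDefect

/-! ## §1 Periodisation of the doubled jump -/

section PeriodiseJ

variable {L b M : ℕ} [NeZero L] [NeZero (b * L)] [NeZero M]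

/-- **(P_T⁺) THE DOUBLED TRANSFER PERIODISES**: `Σ_{(resD Y′) = Y} klLipTransferD (bL) … X′ Y′ = klLipTransferD L … (resD X′) Y` (copy 0: ✓ `klLipTransfer_periodise`; copy 1:
`klPlainShift_periodise`; across copies both sides vanish) — the `hP` of the generic gluing door at `e := klBlockEquivD`. -/
theorem klJumpD_periodise {β : ℝ} (hβ : β ≠ 0) (μ : ℝ) (K : TrigPolyC4v) (J' J : ℕ)
    (X' : SrcLabel (b * L) M J') (Y : SrcLabel L M J) :
    ∑ Y' ∈ univ.filter (fun Y' : SrcLabel (b * L) M J => (klBlockEquivD L b M J Y').2 = Y),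
        klJumpD (b * L) M β μ K J' J X' Y' = klJumpD L M β μ K J' J (klBlockEquivD L b M J' X').2 Y := by
  classical
  obtain ⟨x', s⟩ := X'
  obtain ⟨y, t⟩ := Y
  have h10 : ¬ ((1 : Fin 2) = 0) := by decide
  have h01 : ¬ ((0 : Fin 2) = 1) := by decide
  -- the filter is the product of the residue filter with the singleton copy `t`
  have hfilt : ∀ f : SrcLabel (b * L) M J → ℂ,
      ∑ Y' ∈ univ.filter (fun Y' : SrcLabel (b * L) M J => (klBlockEquivD L b M J Y').2 = (y, t)), f Y' =
        ∑ y' ∈ univ.filter (fun y' : SpaceTimeIdx (b * L) M × SectorLeg (sectorCount J) => klResLabel L b M (sectorCount J) y' = y), f (y', t) := by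
    intro f
    rw [Finset.sum_filter, Finset.sum_filter, Fintype.sum_prod_type]
    refine Finset.sum_congr rfl fun y' _ => ?_
    have hkey : ∀ t' : Fin 2, ((klBlockEquivD L b M J (y', t')).2 = (y, t)) ↔ (klResLabel L b M (sectorCount J) y' = y ∧ t' = t) := by
      intro t'
      rw [klBlockEquivD_apply, klResLabel]
      constructor
      · intro h; exact ⟨congrArg Prod.fst h, congrArg Prod.snd h⟩
      · rintro ⟨h1, h2⟩; rw [h1, h2]
    simp_rw [hkey]
    by_cases hy : klResLabel L b M (sectorCount J) y' = y
    · simp only [hy, true_and, if_true]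
      rw [Finset.sum_ite_eq' univ t, if_pos (Finset.mem_univ _)]
    · simp only [hy, false_and, if_false, Finset.sum_const_zero]
  rw [hfilt, klBlockEquivD_apply, klJumpD_apply]
  simp only [klJumpD_apply]
  rcases Fin.exists_fin_two.1 ⟨s, rfl⟩ with hs | hs <;> rcases Fin.exists_fin_two.1 ⟨t, rfl⟩ with ht | ht <;>
    simp only [hs, ht, h10, h01, and_true, and_false, if_true, if_false, Finset.sum_const_zero]
  · exact klJump_periodise hβ μ K J' J x' y
  · rw [klPlainShift_periodise x' y, klResLabel]

end PeriodiseJ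

/-! ## §2 The six block-reading row data of the doubled jump `klJumpD = klJump ⊕ shift` -/

section TransferRowsJ

variable {L b M : ℕ} [NeZero L] [NeZero (b * L)] [NeZero M]

variable {β : ℝ} (μ : ℝ) (K : TrigPolyC4v) (J' J : ℕ)

omit [NeZero L] [NeZero M] in
/-- Entries of the doubled transfer at explicit copies. -/
theorem klJumpD_apply_00 (x : SpaceTimeIdx (b * L) M × SectorLeg (sectorCount J')) (y : SpaceTimeIdx (b * L) M × SectorLeg (sectorCount J)) :
    klJumpD (b * L) M β μ K J' J (x, 0) (y, 0) = klJump (b * L) M β μ K J' J x y := by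
  rw [klJumpD_apply]; simp

omit [NeZero L] [NeZero M] in
/-- Entries of the doubled transfer at explicit copies. -/
theorem klJumpD_apply_11 (x : SpaceTimeIdx (b * L) M × SectorLeg (sectorCount J')) (y : SpaceTimeIdx (b * L) M × SectorLeg (sectorCount J)) :
    klJumpD (b * L) M β μ K J' J (x, 1) (y, 1) = klPlainShift (b * L) M (sectorCount J') (sectorCount J) x y := by
  rw [klJumpD_apply]; simp

omit [NeZero L] [NeZero M] in
/-- Entries of the doubled transfer at explicit copies. -/
theorem klJumpD_apply_01 (x : SpaceTimeIdx (b * L) M × SectorLeg (sectorCount J')) (y : SpaceTimeIdx (b * L) M × SectorLeg (sectorCount J)) :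
    klJumpD (b * L) M β μ K J' J (x, 0) (y, 1) = 0 := by
  rw [klJumpD_apply]; simp

omit [NeZero L] [NeZero M] in
/-- Entries of the doubled transfer at explicit copies. -/
theorem klJumpD_apply_10 (x : SpaceTimeIdx (b * L) M × SectorLeg (sectorCount J')) (y : SpaceTimeIdx (b * L) M × SectorLeg (sectorCount J)) :
    klJumpD (b * L) M β μ K J' J (x, 1) (y, 0) = 0 := by
  rw [klJumpD_apply]; simp

omit [NeZero M] in
/-- **`hwin⁺`**: windowed block sums of `T ⊕ shift` — the sector datum on copy `0`, `≤ 1 ≤ a` on copy `1` (the shift stays in one block). -/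
theorem hwinJ_le {a : ℝ} (ha1 : 1 ≤ a)
    (hwin : ∀ (B' : Fin 2 → Fin b) (y : SpaceTimeIdx L M × SectorLeg (sectorCount J)),
      ∑ B : Fin 2 → Fin b, ∑ x ∈ univ.filter (fun x : SpaceTimeIdx (b * L) M × SectorLeg (sectorCount J') =>
          (klBlockEquiv L b M (sectorCount J') x).1 = B'),
        ‖klJump (b * L) M β μ K J' J x ((klBlockEquiv L b M (sectorCount J)).symm (B, y))‖ ≤ a)
    (B' : Fin 2 → Fin b) (Y : SrcLabel L M J) :
    ∑ B : Fin 2 → Fin b, ∑ X ∈ univ.filter (fun X : SrcLabel (b * L) M J' => (klBlockEquivD L b M J' X).1 = B'),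
        ‖klJumpD (b * L) M β μ K J' J X ((klBlockEquivD L b M J).symm (B, Y))‖ ≤ a := by
  classical
  obtain ⟨y, t⟩ := Y
  simp_rw [klBlockEquivD_symm_eq, klBlockEquivD_fst]
  simp_rw [sum_filter_fst_srcLabel (fun x : SpaceTimeIdx (b * L) M × SectorLeg (sectorCount J') => (klBlockEquiv L b M (sectorCount J') x).1 = B')]
  rcases Fin.exists_fin_two.1 ⟨t, rfl⟩ with ht | ht
  · simp only [ht, klJumpD_apply_00, klJumpD_apply_10, norm_zero, add_zero]
    exact hwin B' y
  · simp only [ht, klJumpD_apply_01, klJumpD_apply_11, norm_zero, zero_add]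
    -- only the block `B = B'` contributes, and there the shift column is `≤ 1`
    set yf : (Fin 2 → Fin b) → SpaceTimeIdx (b * L) M × SectorLeg (sectorCount J) :=
      fun B => (klBlockEquiv L b M (sectorCount J)).symm (B, y) with hyf
    have hvanish : ∀ B, B ≠ B' → ∑ x ∈ univ.filter (fun x : SpaceTimeIdx (b * L) M × SectorLeg (sectorCount J') =>
        (klBlockEquiv L b M (sectorCount J') x).1 = B'), ‖klPlainShift (b * L) M (sectorCount J') (sectorCount J) x (yf B)‖ = 0 := by
      intro B hB
      refine Finset.sum_eq_zero fun x hx => ?_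
      rw [Finset.mem_filter] at hx
      rw [norm_eq_zero]
      by_contra hne
      have h1 := klBlockEquiv_fst_eq_of_klPlainShift_ne_zero hne
      rw [hx.2, hyf, klBlockEquiv_fst_symm_apply] at h1
      exact hB h1.symm
    rw [Finset.sum_eq_single B' (fun B _ hB => hvanish B hB) (fun h => absurd (Finset.mem_univ _) h)]
    refine le_trans ?_ ha1
    refine (Finset.sum_le_sum_of_subset_of_nonneg (Finset.filter_subset _ _) fun _ _ _ => norm_nonneg _).trans ?_
    exact colSum_norm_klPlainShift_le_one (sectorCount_pos _) _

omit [NeZero M] in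
/-- **`hρ⁺`**: the in-block row of `T ⊕ shift` at the pin — sector datum on copy `0`, `≤ 1 ≤ a` at a plain pin. -/
theorem hrhoJ_le {a : ℝ} (ha1 : 1 ≤ a) (W : SrcLabel (b * L) M J')
    (hρ : W.2 = 0 → ∑ y, ‖klJump (b * L) M β μ K J' J W.1
        ((klBlockEquiv L b M (sectorCount J)).symm ((klBlockEquiv L b M (sectorCount J') W.1).1, y))‖ ≤ a) :
    ∑ Y, ‖klJumpD (b * L) M β μ K J' J W ((klBlockEquivD L b M J).symm ((klBlockEquivD L b M J' W).1, Y))‖ ≤ a := by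
  classical
  obtain ⟨w, s⟩ := W
  simp_rw [klBlockEquivD_symm_eq, klBlockEquivD_fst]
  rw [sum_srcLabel_eq]
  rcases Fin.exists_fin_two.1 ⟨s, rfl⟩ with hs | hs
  · simp only [hs, klJumpD_apply_00, klJumpD_apply_01, norm_zero, add_zero]
    exact hρ hs
  · simp only [hs, klJumpD_apply_10, klJumpD_apply_11, norm_zero, zero_add]
    refine le_trans ?_ ha1
    have hinj : Function.Injective (fun y : SpaceTimeIdx L M × SectorLeg (sectorCount J) =>
        (klBlockEquiv L b M (sectorCount J)).symm ((klBlockEquiv L b M (sectorCount J') w).1, y)) :=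
      fun y y' h => by simpa using (klBlockEquiv L b M (sectorCount J)).symm.injective h
    rw [← Finset.sum_image (f := fun y' => ‖klPlainShift (b * L) M (sectorCount J') (sectorCount J) w y'‖) (fun y _ y' _ h => hinj h)]
    exact rowSum_norm_klPlainShift_le_one (sectorCount_pos _) w _

omit [NeZero M] in
/-- **`hτ₁⁺`**: rows INTO other blocks vanish on the plain copy (the shift stays in one block); copy `0` is the sector datum. -/
theorem htau1J_le {τ : ℝ} (hτ0 : 0 ≤ τ) (W : SrcLabel (b * L) M J')
    (Z : SpaceTimeIdx L M × SectorLeg (sectorCount J) → Prop)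
    (hτ₁ : ∀ y, ¬ Z y → ∑ x ∈ univ.filter (fun x : SpaceTimeIdx (b * L) M × SectorLeg (sectorCount J') =>
        (klBlockEquiv L b M (sectorCount J') x).1 ≠ (klBlockEquiv L b M (sectorCount J') W.1).1),
      ‖klJump (b * L) M β μ K J' J x ((klBlockEquiv L b M (sectorCount J)).symm ((klBlockEquiv L b M (sectorCount J') W.1).1, y))‖ ≤ τ)
    (Y : SrcLabel L M J) (hY : ¬ Z Y.1) :
    ∑ X ∈ univ.filter (fun X : SrcLabel (b * L) M J' => (klBlockEquivD L b M J' X).1 ≠ (klBlockEquivD L b M J' W).1),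
        ‖klJumpD (b * L) M β μ K J' J X ((klBlockEquivD L b M J).symm ((klBlockEquivD L b M J' W).1, Y))‖ ≤ τ := by
  classical
  obtain ⟨y, t⟩ := Y
  simp_rw [klBlockEquivD_symm_eq, klBlockEquivD_fst]
  rw [sum_filter_fst_srcLabel (fun x : SpaceTimeIdx (b * L) M × SectorLeg (sectorCount J') =>
    (klBlockEquiv L b M (sectorCount J') x).1 ≠ (klBlockEquiv L b M (sectorCount J') W.1).1)]
  rcases Fin.exists_fin_two.1 ⟨t, rfl⟩ with ht | ht
  · simp only [ht, klJumpD_apply_00, klJumpD_apply_10, norm_zero, add_zero]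
    exact hτ₁ y hY
  · simp only [ht, klJumpD_apply_01, klJumpD_apply_11, norm_zero, zero_add]
    refine le_trans (le_of_eq (Finset.sum_eq_zero fun x hx => ?_)) hτ0
    rw [Finset.mem_filter] at hx
    rw [norm_eq_zero]
    by_contra hne
    have h1 := klBlockEquiv_fst_eq_of_klPlainShift_ne_zero hne
    rw [klBlockEquiv_fst_symm_apply] at h1
    exact hx.2 h1

omit [NeZero M] in
/-- **`hτ₂⁺`**: the pin's rows into OTHER blocks — sector datum on copy `0`, zero at a plain pin. -/
theorem htau2J_le {τ : ℝ} (hτ0 : 0 ≤ τ) (W : SrcLabel (b * L) M J')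
    (hτ₂ : W.2 = 0 → ∑ B ∈ univ.erase (klBlockEquiv L b M (sectorCount J') W.1).1, ∑ y,
      ‖klJump (b * L) M β μ K J' J W.1 ((klBlockEquiv L b M (sectorCount J)).symm (B, y))‖ ≤ τ) :
    ∑ B ∈ univ.erase (klBlockEquivD L b M J' W).1, ∑ Y,
        ‖klJumpD (b * L) M β μ K J' J W ((klBlockEquivD L b M J).symm (B, Y))‖ ≤ τ := by
  classical
  obtain ⟨w, s⟩ := W
  simp_rw [klBlockEquivD_symm_eq, klBlockEquivD_fst, sum_srcLabel_eq]
  rcases Fin.exists_fin_two.1 ⟨s, rfl⟩ with hs | hs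
  · simp only [hs, klJumpD_apply_00, klJumpD_apply_01, norm_zero, add_zero]
    exact hτ₂ hs
  · simp only [hs, klJumpD_apply_10, klJumpD_apply_11, norm_zero, zero_add]
    refine le_trans (le_of_eq (Finset.sum_eq_zero fun B hB => Finset.sum_eq_zero fun y _ => ?_)) hτ0
    rw [Finset.mem_erase] at hB
    rw [norm_eq_zero]
    by_contra hne
    have h1 := klBlockEquiv_fst_eq_of_klPlainShift_ne_zero hne
    rw [klBlockEquiv_fst_symm_apply] at h1
    exact hB.1 h1.symm

omit [NeZero M] in
/-- **`hτ₃⁺`**: the pin's in-block row over NON-near coarse labels — sector datum on copy `0`; at a plain pin the shift's partner is near (hypothesis `hW`), so the row is zero. -/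
theorem htau3J_le {τ : ℝ} (hτ0 : 0 ≤ τ) (W : SrcLabel (b * L) M J')
    (Near : SpaceTimeIdx L M × SectorLeg (sectorCount J) → Prop) [DecidablePred Near]
    (hτ₃ : W.2 = 0 → ∑ y ∈ univ.filter (fun y : SpaceTimeIdx L M × SectorLeg (sectorCount J) => ¬ Near y),
      ‖klJump (b * L) M β μ K J' J W.1
        ((klBlockEquiv L b M (sectorCount J)).symm ((klBlockEquiv L b M (sectorCount J') W.1).1, y))‖ ≤ τ)
    (hW : W.2 = 1 → ∀ y, klPlainShift (b * L) M (sectorCount J') (sectorCount J) W.1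
        ((klBlockEquiv L b M (sectorCount J)).symm ((klBlockEquiv L b M (sectorCount J') W.1).1, y)) ≠ 0 → Near y) :
    ∑ Y ∈ univ.filter (fun Y : SrcLabel L M J => ¬ Near Y.1),
        ‖klJumpD (b * L) M β μ K J' J W ((klBlockEquivD L b M J).symm ((klBlockEquivD L b M J' W).1, Y))‖ ≤ τ := by
  classical
  obtain ⟨w, s⟩ := W
  simp_rw [klBlockEquivD_symm_eq, klBlockEquivD_fst]
  rw [sum_filter_fst_srcLabel (fun y : SpaceTimeIdx L M × SectorLeg (sectorCount J) => ¬ Near y)]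
  rcases Fin.exists_fin_two.1 ⟨s, rfl⟩ with hs | hs
  · simp only [hs, klJumpD_apply_00, klJumpD_apply_01, norm_zero, add_zero]
    exact hτ₃ hs
  · simp only [hs, klJumpD_apply_10, klJumpD_apply_11, norm_zero, zero_add]
    refine le_trans (le_of_eq (Finset.sum_eq_zero fun y hy => ?_)) hτ0
    rw [Finset.mem_filter] at hy
    rw [norm_eq_zero]
    by_contra hne
    exact hy.2 (hW hs y hne)

omit [NeZero M] in
/-- **`hτ₄⁺`**: in-block rows into labels of OTHER blocks vanish on the plain copy; copy `0` is the sector datum. -/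
theorem htau4J_le {τ : ℝ} (hτ0 : 0 ≤ τ) (W : SrcLabel (b * L) M J')
    (Z : SpaceTimeIdx L M × SectorLeg (sectorCount J) → Prop)
    (hτ₄ : ∀ y, ¬ Z y → ∑ B ∈ univ.erase (klBlockEquiv L b M (sectorCount J') W.1).1,
      ∑ x ∈ univ.filter (fun x : SpaceTimeIdx (b * L) M × SectorLeg (sectorCount J') =>
          (klBlockEquiv L b M (sectorCount J') x).1 = (klBlockEquiv L b M (sectorCount J') W.1).1),
        ‖klJump (b * L) M β μ K J' J x ((klBlockEquiv L b M (sectorCount J)).symm (B, y))‖ ≤ τ)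
    (Y : SrcLabel L M J) (hY : ¬ Z Y.1) :
    ∑ B ∈ univ.erase (klBlockEquivD L b M J' W).1,
      ∑ X ∈ univ.filter (fun X : SrcLabel (b * L) M J' => (klBlockEquivD L b M J' X).1 = (klBlockEquivD L b M J' W).1),
        ‖klJumpD (b * L) M β μ K J' J X ((klBlockEquivD L b M J).symm (B, Y))‖ ≤ τ := by
  classical
  obtain ⟨y, t⟩ := Y
  simp_rw [klBlockEquivD_symm_eq, klBlockEquivD_fst]
  simp_rw [sum_filter_fst_srcLabel (fun x : SpaceTimeIdx (b * L) M × SectorLeg (sectorCount J') =>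
    (klBlockEquiv L b M (sectorCount J') x).1 = (klBlockEquiv L b M (sectorCount J') W.1).1)]
  rcases Fin.exists_fin_two.1 ⟨t, rfl⟩ with ht | ht
  · simp only [ht, klJumpD_apply_00, klJumpD_apply_10, norm_zero, add_zero]
    exact hτ₄ y hY
  · simp only [ht, klJumpD_apply_01, klJumpD_apply_11, norm_zero, zero_add]
    refine le_trans (le_of_eq (Finset.sum_eq_zero fun B hB => Finset.sum_eq_zero fun x hx => ?_)) hτ0
    rw [Finset.mem_erase] at hB
    rw [Finset.mem_filter] at hx
    rw [norm_eq_zero]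
    by_contra hne
    have h1 := klBlockEquiv_fst_eq_of_klPlainShift_ne_zero hne
    rw [klBlockEquiv_fst_symm_apply, hx.2] at h1
    exact hB.1 h1.symm

end TransferRowsJ

end Summit.HubbardSuperconductivity.HubbardSuperconductivity.Theorems.TwoVolumeLip

end
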